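/-
Copyright: internal research formalization. Source text: A. Schrijver, Theory of Linear and Integer
Programming (Wiley 1986) [Schrijver1986], §7.2 "Fundamental theorem of linear inequalities",
Corollary 7.1a (Farkas–Minkowski–Weyl theorem, p. 87): "A convex cone is polyhedral if and only if
it is finitely generated", stated for Mathlib's pointed cones.
-/
import Mathlib
import HarnessLib
import Literature.Analysis.Convex.FarkasMinkowskiWeyl

/-!
# Minkowski–Weyl for pointed cones in `κ → 𝕜`: finitely generated ↔ dually finitely generated

[Schrijver1986] A. Schrijver, *Theory of Linear and Integer Programming*, Wiley 1986, §7.2,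
Corollary 7.1a, p. 87 (Farkas [1898a, 1902], Minkowski [1896], Weyl [1935]): *a convex cone is
polyhedral if and only if it is finitely generated.*

`Literature/Analysis/Convex/FarkasMinkowskiWeyl.lean` proves the corollary in the book's own
coordinates (families `Fin m → κ → 𝕜`, the pairing `dotProduct`, cones as sets).  Mathlib
(`Mathlib/Geometry/Convex/Cone/Pointed.lean`, `…/Dual.lean`, `…/DualFinite.lean`) has the two
notions the corollary compares — `Submodule.FG` of a `PointedCone` ("V-cone", the cone hull
`PointedCone.hull` of a finite set) and `PointedCone.DualFG p` ("H-cone", `PointedCone.dual p s` of a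
finite set `s` for a bilinear pairing `p`) — and its docstring records that *"in finite dimension
the two notions agree by the Minkowski–Weyl theorem"* without a proof.  This file is that bridge
for the coordinate space `κ → 𝕜` (`κ` finite, `𝕜` a linear ordered field) and the pairing
`dotProductBilin 𝕜 𝕜` (`p x y = x ⬝ᵥ y`):

* `mem_hull_range_iff_exists_nonneg` — the cone hull of a finite family is the set of its
  nonnegative combinations (the family form used in the companion file);
* `fg_iff_dualFG_dotProduct` — **Cor. 7.1a**: a pointed cone in `κ → 𝕜` is finitely
  generated iff it is the dual of a finite set, i.e. iff it is `{y | ∀ a ∈ s, 0 ≤ a ⬝ᵥ y}` for a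
  finite `s` (the book's `{x | A x ≤ 0}` with `A` the rows `-a`).

No new definitions; proofs are transport along `Submodule.fg_iff_exists_fin_generating_family`,
`Submodule.mem_span_range_iff_exists_fun` and the two directions
`exists_finset_cone_eq_of_generators` (Weyl) / `exists_generators_of_cone_le` (Minkowski) of the
companion file.
-/

namespace Literature.Analysis.Convex.FarkasMinkowskiWeyl

open Matrix Finset

variable {𝕜 : Type*} [Field 𝕜] [LinearOrder 𝕜] [IsStrictOrderedRing 𝕜]
variable {κ : Type*} [Fintype κ]

/-- **The cone generated by a finite family** (Schrijver 1986, §7.2 (4), p. 87: *"cone{x₁, …, x_m} =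
{λ₁x₁ + … + λ_m x_m | λ₁, …, λ_m ≥ 0}"*) — for Mathlib's `PointedCone.hull` (the span over the
nonnegative scalars) of the range of a finite family: membership is a nonnegative combination.
[cite: Schrijver1986, §7.2 (4) (p. 87)] -/
theorem mem_hull_range_iff_exists_nonneg {E : Type*} [AddCommGroup E] [Module 𝕜 E] {n : ℕ}
    (g : Fin n → E) (x : E) :
    x ∈ PointedCone.hull 𝕜 (Set.range g) ↔
      ∃ l : Fin n → 𝕜, (∀ j, 0 ≤ l j) ∧ ∑ j, l j • g j = x := by
  rw [PointedCone.hull, Submodule.mem_span_range_iff_exists_fun]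
  constructor
  · rintro ⟨c, rfl⟩
    exact ⟨fun j => (c j : 𝕜), fun j => (c j).2, by simp [Nonneg.coe_smul]⟩
  · rintro ⟨l, hl, rfl⟩
    exact ⟨fun j => ⟨l j, hl j⟩, by simp [Nonneg.mk_smul]⟩

/-- **Farkas–Minkowski–Weyl theorem** (Schrijver 1986, Cor. 7.1a, p. 87: *"A convex cone is
polyhedral if and only if it is finitely generated"*) — for Mathlib's pointed cones in the coordinate
space `κ → 𝕜` with the pairing `x ⬝ᵥ y`: `C` is finitely generated (`Submodule.FG`, a V-cone)
iff `C = PointedCone.dual (dotProductBilin 𝕜 𝕜) s = {y | ∀ a ∈ s, 0 ≤ a ⬝ᵥ y}` for a finite set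
`s` (`PointedCone.DualFG`, an H-cone). [cite: Schrijver1986, Cor 7.1a (p. 87-88)] -/
theorem fg_iff_dualFG_dotProduct (C : PointedCone 𝕜 (κ → 𝕜)) :
    C.FG ↔ C.DualFG (dotProductBilin 𝕜 𝕜 (m := κ) (A := 𝕜)) := by
  classical
  constructor
  · -- Weyl: a finitely generated cone is polyhedral
    intro hC
    obtain ⟨m, g, hg⟩ := Submodule.fg_iff_exists_fin_generating_family.mp hC
    obtain ⟨t, ht⟩ := exists_finset_cone_eq_of_generators (𝕜 := 𝕜) (κ := κ) m g
    refine ⟨t.image (fun a => -a), ?_⟩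
    ext y
    rw [PointedCone.mem_dual, ← hg]
    change _ ↔ y ∈ PointedCone.hull 𝕜 (Set.range g)
    rw [mem_hull_range_iff_exists_nonneg, ht y]
    simp only [coe_image, Set.forall_mem_image, mem_coe, dotProductBilin_apply_apply, neg_dotProduct,
      neg_nonneg]
  · -- Minkowski: a polyhedral cone is finitely generated
    rintro ⟨s, hs⟩
    obtain ⟨a, ha⟩ : ∃ a : Fin s.card → κ → 𝕜, Set.range a = (↑s : Set (κ → 𝕜)) :=
      ⟨fun i => (s.equivFin.symm i : κ → 𝕜), by
        ext x; constructor
        · rintro ⟨i, rfl⟩; exact (s.equivFin.symm i).2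
        · intro hx; exact ⟨s.equivFin ⟨x, hx⟩, by simp⟩⟩
    obtain ⟨n, g, hg⟩ := exists_generators_of_cone_le (𝕜 := 𝕜) (κ := κ) s.card (fun i => -a i)
    rw [Submodule.fg_iff_exists_fin_generating_family]
    refine ⟨n, g, ?_⟩
    rw [← hs]
    ext y
    change y ∈ PointedCone.hull 𝕜 (Set.range g) ↔ _
    rw [mem_hull_range_iff_exists_nonneg, ← hg y, PointedCone.mem_dual, ← ha]
    simp only [Set.forall_mem_range, dotProductBilin_apply_apply, neg_dotProduct, neg_nonpos]

end Literature.Analysis.Convex.FarkasMinkowskiWeyl
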